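import Literature.Probability.Percolation.TriUQuad
import Literature.Probability.Percolation.TriPathCrossings
import Literature.Probability.Percolation.TriRSWChaining
import HarnessLib

/-!
# Corridors inside the inner half-box: the band along the inner arc

Topic `Literature/Probability/Percolation`; family `crit-perc`, statement **crit-perc.S16**
(`Literature.Probability.Percolation.triTheta_exponent`). The deterministic part of the
"extension by RSW corridors" of Kesten's arm separation in the U-shaped half-plane region
(P. Nolin, EJP 13 (2008), §4.3 Lemma 12 and §4.5, proof of Prop. 17 [arXiv 0711.4948:
Lemma 11, Prop. 16]: "we can extend the arms inside sub-domains by RSW-type constructions"),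
in the form used here: inside the inner half-box `I = [-k+1, k-1] × [0, k-1]` a **band** of
width `W` runs along the inner arc — the left leg `[-k+1, -k+W] × [0, k-W-1]`, the top part
`[-k+1, k-1] × [k-2W, k-W-1]`, the right leg `[k-W, k-1] × [0, k-W-1]`; open long-way
crossings of (parts of) these rectangles link a fence (`TriUQuadFences.lean`) to a real point
of `I`.

* `boxZ`, `hCrossZ`, `vCrossZ` — integer boxes `[x₁, x₂] × [r₁, r₂]` and their horizontal /
  vertical open crossing events; `hCrossZ_eq_triHCross`, `vCrossZ_eq_triVCross` identify them
  with the translated crossing events of `TriRSWChaining.lean` (hence probabilities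
  `triLRCrossingProb`, determining sets, monotonicity).
* `joinedDown k ω` — the sites joined to a real point (row `0`) by an `ω`-open path of `I`.
* `supports_meet` — a horizontal and a vertical support in "plus" position share a site
  (`PathIn.exists_slab_crossing` + `PathIn.tri_crossings_meet`).
* `exists_support_of_hCrossZ`, `exists_support_of_vCrossZ`, `joinedDown_of_vCrossZ_floor`,
  `joinedDown_of_hCrossZ_meets`, `joinedDown_of_vCrossZ_meets`, `joinedDown_fenceV`,
  `joinedDown_fenceH` — propagation of "joined down" from the floor along the band to a fence.
* `exists_realPoint_of_joinedDown` — a fence base joined down and joined to `S` gives a real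
  point of `I` joined to `S` by an `ω`-open path of `U ∪ I`.

## References

* P. Nolin, Near-critical percolation in two dimensions, *Electron. J. Probab.* 13 (2008), §4.3
  Lemma 12, §4.5 proof of Prop. 17 [arXiv 0711.4948: Lemma 11, Prop. 16] [Nolin2008].
* H. Kesten, Scaling relations for 2D-percolation, *Comm. Math. Phys.* 109 (1987), Lemma 4
  and (2.41)–(2.42) [KestenScalingCMP1987].

## Mathlib / tree

Tree: `triStrip`, `triHCross`, `triVCross` (`TriRSWChaining.lean`), `PathIn.exists_slab_crossing`
(`TriPathCrossings.lean`), `PathIn.tri_crossings_meet` (`TriCrossingsMeet.lean`),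
`PathIn.exists_support`, `uInner`, `uSites` (`TriUQuad.lean`).
-/

noncomputable section

open Set

namespace Literature.Probability.Percolation

open LatticeModels

/-! ### Integer boxes and their crossing events -/

/-- The box `[x₁, x₂] × [r₁, r₂]` of `𝕋` (integer corners). [folklore] -/
def boxZ (x₁ x₂ r₁ r₂ : ℤ) : Set (Site 2) := {z | x₁ ≤ z 0 ∧ z 0 ≤ x₂ ∧ r₁ ≤ z 1 ∧ z 1 ≤ r₂}

/-- Membership in `boxZ`. [folklore] -/
@[simp] theorem mem_boxZ {x₁ x₂ r₁ r₂ : ℤ} {z : Site 2} :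
    z ∈ boxZ x₁ x₂ r₁ r₂ ↔ x₁ ≤ z 0 ∧ z 0 ≤ x₂ ∧ r₁ ≤ z 1 ∧ z 1 ≤ r₂ := Iff.rfl

/-- **Horizontal open crossing** of `[x₁, x₂] × [r₁, r₂]`. [cite: KestenPTM1982, §3.3 Defs. 1–3] -/
def hCrossZ (x₁ x₂ r₁ r₂ : ℤ) : Set (Set (Site 2)) :=
  {ω | ∃ c d : Site 2, c 0 = x₁ ∧ d 0 = x₂ ∧ PathIn triGraph (boxZ x₁ x₂ r₁ r₂ ∩ ω) c d}

/-- **Vertical open crossing** of `[x₁, x₂] × [r₁, r₂]`. [cite: KestenPTM1982, §3.3 Defs. 1–3] -/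
def vCrossZ (x₁ x₂ r₁ r₂ : ℤ) : Set (Set (Site 2)) :=
  {ω | ∃ c d : Site 2, c 1 = r₁ ∧ d 1 = r₂ ∧ PathIn triGraph (boxZ x₁ x₂ r₁ r₂ ∩ ω) c d}

/-- A non-degenerate integer box is a translated parallelogram `triStrip`. [folklore] -/
theorem boxZ_eq_triStrip {x₁ x₂ r₁ r₂ : ℤ} (hx : x₁ ≤ x₂) (hr : r₁ ≤ r₂) :
    boxZ x₁ x₂ r₁ r₂ = triStrip x₁ r₁ (x₂ - x₁).toNat (r₂ - r₁).toNat := by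
  ext z
  rw [mem_boxZ, mem_triStrip, Int.toNat_of_nonneg (by omega), Int.toNat_of_nonneg (by omega)]
  constructor
  · rintro ⟨h1, h2, h3, h4⟩; exact ⟨h1, by omega, h3, by omega⟩
  · rintro ⟨h1, h2, h3, h4⟩; exact ⟨h1, by omega, h3, by omega⟩

/-- Horizontal crossings of integer boxes are translated horizontal crossings. [folklore] -/
theorem hCrossZ_eq_triHCross {x₁ x₂ r₁ r₂ : ℤ} (hx : x₁ ≤ x₂) (hr : r₁ ≤ r₂) :
    hCrossZ x₁ x₂ r₁ r₂ = triHCross x₁ r₁ (x₂ - x₁).toNat (r₂ - r₁).toNat := by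
  ext ω
  simp only [hCrossZ, triHCross, mem_setOf_eq, boxZ_eq_triStrip hx hr]
  rw [Int.toNat_of_nonneg (by omega)]
  constructor
  · rintro ⟨c, d, hc, hd, hp⟩; exact ⟨c, d, hc, by omega, hp⟩
  · rintro ⟨c, d, hc, hd, hp⟩; exact ⟨c, d, hc, by omega, hp⟩

/-- Vertical crossings of integer boxes are translated vertical crossings. [folklore] -/
theorem vCrossZ_eq_triVCross {x₁ x₂ r₁ r₂ : ℤ} (hx : x₁ ≤ x₂) (hr : r₁ ≤ r₂) :
    vCrossZ x₁ x₂ r₁ r₂ = triVCross x₁ r₁ (x₂ - x₁).toNat (r₂ - r₁).toNat := by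
  ext ω
  simp only [vCrossZ, triVCross, mem_setOf_eq, boxZ_eq_triStrip hx hr]
  rw [Int.toNat_of_nonneg (show 0 ≤ r₂ - r₁ by omega)]
  constructor
  · rintro ⟨c, d, hc, hd, hp⟩; exact ⟨c, d, hc, by omega, hp⟩
  · rintro ⟨c, d, hc, hd, hp⟩; exact ⟨c, d, hc, by omega, hp⟩

/-- Horizontal crossings are increasing events. [folklore] -/
theorem isUpperSet_hCrossZ (x₁ x₂ r₁ r₂ : ℤ) : IsUpperSet (hCrossZ x₁ x₂ r₁ r₂) := by
  rintro ω ω' hle ⟨c, d, hc, hd, h⟩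
  exact ⟨c, d, hc, hd, h.mono fun z hz => ⟨hz.1, hle hz.2⟩⟩

/-- Vertical crossings are increasing events. [folklore] -/
theorem isUpperSet_vCrossZ (x₁ x₂ r₁ r₂ : ℤ) : IsUpperSet (vCrossZ x₁ x₂ r₁ r₂) := by
  rintro ω ω' hle ⟨c, d, hc, hd, h⟩
  exact ⟨c, d, hc, hd, h.mono fun z hz => ⟨hz.1, hle hz.2⟩⟩

/-- A horizontal crossing has a tight support inside the box. [folklore] -/
theorem exists_support_of_hCrossZ {x₁ x₂ r₁ r₂ : ℤ} {ω : Set (Site 2)} (h : ω ∈ hCrossZ x₁ x₂ r₁ r₂) :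
    ∃ (T : Set (Site 2)) (c d : Site 2), T ⊆ boxZ x₁ x₂ r₁ r₂ ∩ ω ∧ PathIn triGraph T c d ∧
      c 0 = x₁ ∧ d 0 = x₂ ∧ ∀ z ∈ T, PathIn triGraph T c z := by
  obtain ⟨c, d, hc, hd, hp⟩ := h
  obtain ⟨T, hT, hTp, hTt⟩ := hp.exists_support
  exact ⟨T, c, d, hT, hTp, hc, hd, hTt⟩

/-- A vertical crossing has a tight support inside the box. [folklore] -/
theorem exists_support_of_vCrossZ {x₁ x₂ r₁ r₂ : ℤ} {ω : Set (Site 2)} (h : ω ∈ vCrossZ x₁ x₂ r₁ r₂) :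
    ∃ (T : Set (Site 2)) (c d : Site 2), T ⊆ boxZ x₁ x₂ r₁ r₂ ∩ ω ∧ PathIn triGraph T c d ∧
      c 1 = r₁ ∧ d 1 = r₂ ∧ ∀ z ∈ T, PathIn triGraph T c z := by
  obtain ⟨c, d, hc, hd, hp⟩ := h
  obtain ⟨T, hT, hTp, hTt⟩ := hp.exists_support
  exact ⟨T, c, d, hT, hTp, hc, hd, hTt⟩

/-! ### Supports in plus position meet -/

/-- **A horizontal and a vertical support in plus position meet**: if `TH ⊆ [x₁, x₂] × [r₁, r₂]`
carries a path from `{x₀ = x₁}` to `{x₀ = x₂}` and `TV ⊆ [x₁', x₂'] × [r₁', r₂']` a path from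
`{x₁ = r₁'}` to `{x₁ = r₂'}`, with `[x₁', x₂'] ⊆ [x₁, x₂]` and `[r₁, r₂] ⊆ [r₁', r₂']`, then
`TH ∩ TV ≠ ∅` (sub-crossings of the common rectangle `[x₁', x₂'] × [r₁, r₂]` meet). [cite: KestenPTM1982, §2.2 (paths crossing a rectangle must intersect)] -/
theorem supports_meet {TH TV : Set (Site 2)} {x₁ x₂ r₁ r₂ x₁' x₂' r₁' r₂' : ℤ}
    (hTH : ∀ z ∈ TH, x₁ ≤ z 0 ∧ z 0 ≤ x₂ ∧ r₁ ≤ z 1 ∧ z 1 ≤ r₂) {c d : Site 2}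
    (hpH : PathIn triGraph TH c d) (hc : c 0 = x₁) (hd : d 0 = x₂)
    (hTV : ∀ z ∈ TV, x₁' ≤ z 0 ∧ z 0 ≤ x₂' ∧ r₁' ≤ z 1 ∧ z 1 ≤ r₂') {e f : Site 2}
    (hpV : PathIn triGraph TV e f) (he : e 1 = r₁') (hf : f 1 = r₂')
    (h₁ : x₁ ≤ x₁') (h₁₂ : x₁' ≤ x₂') (h₂ : x₂' ≤ x₂) (h₃ : r₁' ≤ r₁) (h₃₄ : r₁ ≤ r₂) (h₄ : r₂ ≤ r₂') :
    ∃ z, z ∈ TH ∧ z ∈ TV := by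
  obtain ⟨c', d', hc', hd', hp'⟩ := hpH.exists_slab_crossing 0 (L := x₁') (R := x₂') h₁₂ (by omega) (by omega)
  obtain ⟨e', f', he', hf', hq'⟩ := hpV.exists_slab_crossing 1 (L := r₁) (R := r₂) h₃₄ (by omega) (by omega)
  obtain ⟨z, hz, hz'⟩ := PathIn.tri_crossings_meet (L := x₁') (R := x₂') (B := r₁) (T := r₂)
    (A := TH ∩ {z : Site 2 | x₁' ≤ z 0 ∧ z 0 ≤ x₂'}) (A' := TV ∩ {z : Site 2 | r₁ ≤ z 1 ∧ z 1 ≤ r₂})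
    (fun z hz => by
      have h1 := hTH z hz.1
      have h2 := hz.2
      simp only [mem_setOf_eq] at h2
      omega)
    (fun z hz => by
      have h1 := hTV z hz.1
      have h2 := hz.2
      simp only [mem_setOf_eq] at h2
      omega)
    hp' hc' hd' hq' he' hf'
  exact ⟨z, hz.1, hz'.1⟩

/-! ### Sites joined to a real point inside the inner half-box -/

/-- **Joined down**: the sites joined to a real point (row `0`) by an `ω`-open path of the inner
half-box `I = uInner k`. [cite: Nolin2008, §4.5, proof of Prop. 17 (arXiv 0711.4948: Prop. 16)] -/
def joinedDown (k : ℕ) (ω : Set (Site 2)) : Set (Site 2) :=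
  {v | ∃ x : Site 2, x 1 = 0 ∧ PathIn triGraph (ω ∩ uInner k) x v}

variable {k : ℕ} {ω : Set (Site 2)}

/-- `joinedDown` is closed under open paths of `I`. [folklore] -/
theorem joinedDown_of_pathIn {v w : Site 2} (hv : v ∈ joinedDown k ω)
    (hp : PathIn triGraph (ω ∩ uInner k) v w) : w ∈ joinedDown k ω := by
  obtain ⟨x, hx, hxv⟩ := hv
  exact ⟨x, hx, hxv.trans hp⟩

/-- An open real point of `I` is joined down. [folklore] -/
theorem mem_joinedDown_of_row_zero {x : Site 2} (hx1 : x 1 = 0) (hx : x ∈ ω ∩ uInner k) :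
    x ∈ joinedDown k ω := ⟨x, hx1, PathIn.refl hx⟩

/-- A tight support inside `ω ∩ I` containing a site joined down is entirely joined down. [folklore] -/
theorem joinedDown_of_tight {T : Set (Site 2)} (hT : T ⊆ ω ∩ uInner k) {t₀ : Site 2}
    (htight : ∀ z ∈ T, PathIn triGraph T t₀ z) {z : Site 2} (hz : z ∈ T) (hzj : z ∈ joinedDown k ω)
    {w : Site 2} (hw : w ∈ T) : w ∈ joinedDown k ω :=
  joinedDown_of_pathIn hzj (((htight z hz).symm.trans (htight w hw)).mono hT)

/-- **The floor of a leg is joined down**: an open vertical crossing of a box of `I` standing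
on the real line has a tight support all of whose sites are joined down. [cite: Nolin2008, §4.5, proof of Prop. 17 (arXiv 0711.4948: Prop. 16)] -/
theorem joinedDown_of_vCrossZ_floor {x₁ x₂ r : ℤ} (hbox : boxZ x₁ x₂ 0 r ⊆ uInner k)
    (h : ω ∈ vCrossZ x₁ x₂ 0 r) :
    ∃ (T : Set (Site 2)) (e f : Site 2), T ⊆ boxZ x₁ x₂ 0 r ∩ ω ∧ PathIn triGraph T e f ∧
      e 1 = 0 ∧ f 1 = r ∧ (∀ z ∈ T, PathIn triGraph T e z) ∧ ∀ z ∈ T, z ∈ joinedDown k ω := by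
  obtain ⟨T, e, f, hT, hp, he, hf, ht⟩ := exists_support_of_vCrossZ h
  have hT' : T ⊆ ω ∩ uInner k := fun z hz => ⟨(hT hz).2, hbox (hT hz).1⟩
  refine ⟨T, e, f, hT, hp, he, hf, ht, fun z hz => ?_⟩
  exact joinedDown_of_tight hT' ht hp.left_mem (mem_joinedDown_of_row_zero he (hT' hp.left_mem)) hz

/-- **Propagation to a horizontal crossing**: an open horizontal crossing of a box of `I` in plus
position with a vertical support all joined down has a tight support all joined down. [cite: Nolin2008, §4.5, proof of Prop. 17 (arXiv 0711.4948: Prop. 16)] -/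
theorem joinedDown_of_hCrossZ_meets {x₁ x₂ r₁ r₂ x₁' x₂' r₁' r₂' : ℤ} {TV : Set (Site 2)}
    (hTV : ∀ z ∈ TV, x₁' ≤ z 0 ∧ z 0 ≤ x₂' ∧ r₁' ≤ z 1 ∧ z 1 ≤ r₂') {e f : Site 2}
    (hpV : PathIn triGraph TV e f) (he : e 1 = r₁') (hf : f 1 = r₂') (hjV : ∀ z ∈ TV, z ∈ joinedDown k ω)
    (hbox : boxZ x₁ x₂ r₁ r₂ ⊆ uInner k) (h : ω ∈ hCrossZ x₁ x₂ r₁ r₂)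
    (h₁ : x₁ ≤ x₁') (h₁₂ : x₁' ≤ x₂') (h₂ : x₂' ≤ x₂) (h₃ : r₁' ≤ r₁) (h₃₄ : r₁ ≤ r₂) (h₄ : r₂ ≤ r₂') :
    ∃ (T : Set (Site 2)) (c d : Site 2), T ⊆ boxZ x₁ x₂ r₁ r₂ ∩ ω ∧ PathIn triGraph T c d ∧
      c 0 = x₁ ∧ d 0 = x₂ ∧ (∀ z ∈ T, PathIn triGraph T c z) ∧ ∀ z ∈ T, z ∈ joinedDown k ω := by
  obtain ⟨T, c, d, hT, hp, hc, hd, ht⟩ := exists_support_of_hCrossZ h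
  have hT' : T ⊆ ω ∩ uInner k := fun z hz => ⟨(hT hz).2, hbox (hT hz).1⟩
  obtain ⟨z, hzT, hzV⟩ := supports_meet (fun z hz => (mem_boxZ.1 (hT hz).1)) hp hc hd hTV hpV he hf
    h₁ h₁₂ h₂ h₃ h₃₄ h₄
  exact ⟨T, c, d, hT, hp, hc, hd, ht, fun w hw => joinedDown_of_tight hT' ht hzT (hjV z hzV) hw⟩

/-- **Propagation to a vertical crossing**: an open vertical crossing of a box of `I` in plus
position with a horizontal support all joined down has a tight support all joined down. [cite: Nolin2008, §4.5, proof of Prop. 17 (arXiv 0711.4948: Prop. 16)] -/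
theorem joinedDown_of_vCrossZ_meets {x₁ x₂ r₁ r₂ x₁' x₂' r₁' r₂' : ℤ} {TH : Set (Site 2)}
    (hTH : ∀ z ∈ TH, x₁ ≤ z 0 ∧ z 0 ≤ x₂ ∧ r₁ ≤ z 1 ∧ z 1 ≤ r₂) {c d : Site 2}
    (hpH : PathIn triGraph TH c d) (hc : c 0 = x₁) (hd : d 0 = x₂) (hjH : ∀ z ∈ TH, z ∈ joinedDown k ω)
    (hbox : boxZ x₁' x₂' r₁' r₂' ⊆ uInner k) (h : ω ∈ vCrossZ x₁' x₂' r₁' r₂')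
    (h₁ : x₁ ≤ x₁') (h₁₂ : x₁' ≤ x₂') (h₂ : x₂' ≤ x₂) (h₃ : r₁' ≤ r₁) (h₃₄ : r₁ ≤ r₂) (h₄ : r₂ ≤ r₂') :
    ∃ (T : Set (Site 2)) (e f : Site 2), T ⊆ boxZ x₁' x₂' r₁' r₂' ∩ ω ∧ PathIn triGraph T e f ∧
      e 1 = r₁' ∧ f 1 = r₂' ∧ (∀ z ∈ T, PathIn triGraph T e z) ∧ ∀ z ∈ T, z ∈ joinedDown k ω := by
  obtain ⟨T, e, f, hT, hp, he, hf, ht⟩ := exists_support_of_vCrossZ h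
  have hT' : T ⊆ ω ∩ uInner k := fun z hz => ⟨(hT hz).2, hbox (hT hz).1⟩
  obtain ⟨z, hzH, hzT⟩ := supports_meet hTH hpH hc hd (fun z hz => (mem_boxZ.1 (hT hz).1)) hp he hf
    h₁ h₁₂ h₂ h₃ h₃₄ h₄
  exact ⟨T, e, f, hT, hp, he, hf, ht, fun w hw => joinedDown_of_tight hT' ht hzT (hjH z hzH) hw⟩

/-- **A vertical fence in plus position with a horizontal support joined down is joined down**
(the fence `X ⊆ I ∩ ω` is the tight support of a top–bottom path of `[x₁', x₂'] × [r₁', r₂']`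
from its base `a`). [cite: Nolin2008, §4.2 Def. 6, §4.5 proof of Prop. 17 (arXiv 0711.4948: Def. 6, Prop. 16)] -/
theorem joinedDown_fenceV {x₁ x₂ r₁ r₂ x₁' x₂' r₁' r₂' : ℤ} {TH X : Set (Site 2)}
    (hTH : ∀ z ∈ TH, x₁ ≤ z 0 ∧ z 0 ≤ x₂ ∧ r₁ ≤ z 1 ∧ z 1 ≤ r₂) {c d : Site 2}
    (hpH : PathIn triGraph TH c d) (hc : c 0 = x₁) (hd : d 0 = x₂) (hjH : ∀ z ∈ TH, z ∈ joinedDown k ω)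
    (hX : X ⊆ uInner k ∩ ω) (bX : ∀ z ∈ X, x₁' ≤ z 0 ∧ z 0 ≤ x₂' ∧ r₁' ≤ z 1 ∧ z 1 ≤ r₂')
    {a b : Site 2} (hpX : PathIn triGraph X a b) (ha : a 1 = r₁') (hb : b 1 = r₂')
    (htX : ∀ z ∈ X, PathIn triGraph X a z)
    (h₁ : x₁ ≤ x₁') (h₁₂ : x₁' ≤ x₂') (h₂ : x₂' ≤ x₂) (h₃ : r₁' ≤ r₁) (h₃₄ : r₁ ≤ r₂) (h₄ : r₂ ≤ r₂') :
    a ∈ joinedDown k ω := by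
  obtain ⟨z, hzH, hzX⟩ := supports_meet hTH hpH hc hd bX hpX ha hb h₁ h₁₂ h₂ h₃ h₃₄ h₄
  exact joinedDown_of_pathIn (hjH z hzH) ((htX z hzX).symm.mono fun w hw => ⟨(hX hw).2, (hX hw).1⟩)

/-- **A horizontal fence in plus position with a vertical support joined down is joined down.** [cite: Nolin2008, §4.2 Def. 6, §4.5 proof of Prop. 17 (arXiv 0711.4948: Def. 6, Prop. 16)] -/
theorem joinedDown_fenceH {x₁ x₂ r₁ r₂ x₁' x₂' r₁' r₂' : ℤ} {TV X : Set (Site 2)}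
    (hTV : ∀ z ∈ TV, x₁' ≤ z 0 ∧ z 0 ≤ x₂' ∧ r₁' ≤ z 1 ∧ z 1 ≤ r₂') {e f : Site 2}
    (hpV : PathIn triGraph TV e f) (he : e 1 = r₁') (hf : f 1 = r₂') (hjV : ∀ z ∈ TV, z ∈ joinedDown k ω)
    (hX : X ⊆ uInner k ∩ ω) (bX : ∀ z ∈ X, x₁ ≤ z 0 ∧ z 0 ≤ x₂ ∧ r₁ ≤ z 1 ∧ z 1 ≤ r₂)
    {a b : Site 2} (hpX : PathIn triGraph X a b) (ha : a 0 = x₁) (hb : b 0 = x₂)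
    (htX : ∀ z ∈ X, PathIn triGraph X a z)
    (h₁ : x₁ ≤ x₁') (h₁₂ : x₁' ≤ x₂') (h₂ : x₂' ≤ x₂) (h₃ : r₁' ≤ r₁) (h₃₄ : r₁ ≤ r₂) (h₄ : r₂ ≤ r₂') :
    a ∈ joinedDown k ω := by
  obtain ⟨z, hzX, hzV⟩ := supports_meet bX hpX ha hb hTV hpV he hf h₁ h₁₂ h₂ h₃ h₃₄ h₄
  exact joinedDown_of_pathIn (hjV z hzV) ((htX z hzX).symm.mono fun w hw => ⟨(hX hw).2, (hX hw).1⟩)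

/-- **From a fence joined down to a good real point**: if the base `a` of a fence is joined down
and joined to a site of `S` by an `ω`-open path of `U ∪ I`, then some real point `x` of `I`
(`x₁ = 0`, `-k + 1 ≤ x₀ ≤ k - 1`) is joined to a site of `S` by an `ω`-open path of `U ∪ I`. [cite: Nolin2008, §4.5, proof of Prop. 17 (arXiv 0711.4948: Prop. 16)] -/
theorem exists_realPoint_of_joinedDown {N : ℕ} {S : Set (Site 2)} {a : Site 2}
    (ha : a ∈ joinedDown k ω)
    (hg : ∃ g ∈ S, PathIn triGraph (ω ∩ (↑(uSites k N) ∪ uInner k)) a g) :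
    ∃ x : Site 2, x 1 = 0 ∧ -(k : ℤ) + 1 ≤ x 0 ∧ x 0 ≤ k - 1 ∧
      ∃ g ∈ S, PathIn triGraph (ω ∩ (↑(uSites k N) ∪ uInner k)) x g := by
  obtain ⟨x, hx1, hp⟩ := ha
  obtain ⟨g, hgS, hq⟩ := hg
  have hxI := (mem_uInner.1 hp.left_mem.2)
  have hp' : PathIn triGraph (ω ∩ (↑(uSites k N) ∪ uInner k)) x a :=
    hp.mono fun z hz => ⟨hz.1, Or.inr hz.2⟩
  exact ⟨x, hx1, hxI.1, hxI.2.1, g, hgS, hp'.trans hq⟩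

end Literature.Probability.Percolation
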